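import Mathlib.Analysis.SpecialFunctions.SmoothTransition
import Literature.Analysis.FluidPDE.ElgindiStripCalculus
import HarnessLib

/-!
# Cut-offs for Elgindi's weighted spaces: separable products, the radial cut-off `χ(z/M) − 1`
with `M`-uniform bounds on its `D_z`-iterates, and the radial bump

Topic `Literature/Analysis/FluidPDE`. Support file (everything proved, no named facts) of the
discharge of the §2.6 datum fact `ElgindiGhoulMasmoudi2021_compactSupportDatum`
(`ElgindiStabilityDecomposition.lean`; Elgindi–Ghoul–Masmoudi, Camb. J. Math. 9 (2021) =
arXiv:1910.14071, §2.6 p. 9: "`ε₀^{M,β} = (χ(z/M) − 1)F + β sin(2θ)χ((z−3)²)`", with Remark 9.8,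
p. 20: "if we consider `χ^M(z) := χ(z/M)`, then `|D_z^j(χ^M)|_{L^∞} ≤ C_j` for all `j ≤ k` (the
bound is independent of `M`)"). It provides the one-variable calculus the cut-off needs:

* the one-variable angular operator `Dθ₁ g = sin(2θ) g'` and **separable products**
  `tensor R G (z, θ) = R(z)G(θ)`: `D_θ^i D_z^j (R ⊗ G) = (Dz₁^j R) ⊗ (Dθ₁^i G)` *globally*, with no
  differentiability hypothesis (`iterate_Dθ_Dz_tensor`; the slice `deriv`s see a constant
  factor);
* `Dz₁`-iterates of a function vanish on an open set where it vanishes, and iterates of positive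
  order vanish where it is locally constant (`iterate_Dz₁_eq_zero_of_eqOn`,
  `iterate_Dz₁_succ_eq_zero_of_const`); the **dilation invariance**
  `Dz₁^l (g(·/M)) = (Dz₁^l g)(·/M)` (`iterate_Dz₁_comp_div`), which is Remark 9.8;
* the cut-off profile `cutProfile t = −smoothTransition(t − 1)` (`= 0` on `t ≤ 1`, `= −1` on
  `t ≥ 2`, smooth, `|·| ≤ 1`), the cut-off `tailCut M z = cutProfile (z/M)` (`= 0` on `z ≤ M`,
  `= −1` on `z ≥ 2M`) with **bounds on `Dz₁^l (tailCut M)` uniform in `M`**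
  (`exists_abs_iterate_Dz₁_tailCut_le`), and the radial bump
  `bumpRadial z = smoothTransition(z − 1) smoothTransition(4 − z)` (smooth, `0 ≤ · ≤ 1`, `= 0` off
  `(1, 4)`, `> 0` on `(1, 4)`, bounded `Dz₁`-iterates).

Everything is folklore calculus; the operators are those of [ElgindiGhoulMasmoudi2021] §1.7 (p. 6)
as rendered in `ElgindiWeightedSpaces.lean` / `ElgindiStripCalculus.lean`. Used from Mathlib:
`Real.smoothTransition` (with `zero_of_nonpos`, `one_of_one_le`, `contDiff`),
`deriv_mul_const_field`, `deriv_const_mul_field`, `Filter.EventuallyEq.deriv_eq`,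
`IsCompact.exists_bound_of_continuousOn`.
-/

noncomputable section

open Set Function Real Filter
open _root_.Topology

namespace Literature.Analysis.FluidPDE

namespace Elgindi

/-! ### The one-variable angular operator and separable products -/

/-- The one-variable angular scaling derivative `Dθ₁ g = sin(2θ) g'` (the action of `D_θ` of
Elgindi–Ghoul–Masmoudi 2021, §1.7, on a function of `θ` alone). [cite: ElgindiGhoulMasmoudi2021, §1.7 (p. 6 of arXiv:1910.14071): D_θ = sin(2θ)∂_θ] -/
def Dθ₁ (g : ℝ → ℝ) (θ : ℝ) : ℝ :=
  Real.sin (2 * θ) * deriv g θ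

/-- Unfolding `Dθ₁`. [folklore] -/
theorem Dθ₁_apply (g : ℝ → ℝ) (θ : ℝ) : Dθ₁ g θ = Real.sin (2 * θ) * deriv g θ := rfl

/-- The separable product `(R ⊗ G)(z, θ) = R(z) G(θ)` of a radial and an angular function. [folklore] -/
def tensor (R G : ℝ → ℝ) : ℝ → ℝ → ℝ :=
  fun z θ => R z * G θ

/-- Unfolding `tensor`. [folklore] -/
@[simp] theorem tensor_apply (R G : ℝ → ℝ) (z θ : ℝ) : tensor R G z θ = R z * G θ := rfl

/-- `D_z (R ⊗ G) = (Dz₁ R) ⊗ G`, globally (the slice derivative sees the constant factor `G(θ)`). [folklore] -/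
theorem Dz_tensor (R G : ℝ → ℝ) : Dz (tensor R G) = tensor (Dz₁ R) G := by
  funext z θ
  simp only [Dz_apply, tensor, Dz₁_apply, deriv_mul_const_field]
  ring

/-- `D_θ (R ⊗ G) = R ⊗ (Dθ₁ G)`, globally. [folklore] -/
theorem Dθ_tensor (R G : ℝ → ℝ) : Dθ (tensor R G) = tensor R (Dθ₁ G) := by
  funext z θ
  simp only [Dθ_apply, tensor, Dθ₁_apply, deriv_const_mul_field]
  ring

/-- `D_z^j (R ⊗ G) = (Dz₁^j R) ⊗ G`. [folklore] -/
theorem iterate_Dz_tensor (R G : ℝ → ℝ) (j : ℕ) : Dz^[j] (tensor R G) = tensor (Dz₁^[j] R) G := by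
  induction j with
  | zero => rfl
  | succ j ih => rw [iterate_succ_apply', iterate_succ_apply', ih, Dz_tensor]

/-- `D_θ^i (R ⊗ G) = R ⊗ (Dθ₁^i G)`. [folklore] -/
theorem iterate_Dθ_tensor (R G : ℝ → ℝ) (i : ℕ) : Dθ^[i] (tensor R G) = tensor R (Dθ₁^[i] G) := by
  induction i with
  | zero => rfl
  | succ i ih => rw [iterate_succ_apply', iterate_succ_apply', ih, Dθ_tensor]

/-- **Mixed iterates of a separable product**: `D_θ^i D_z^j (R ⊗ G) = (Dz₁^j R) ⊗ (Dθ₁^i G)`,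
globally and without any differentiability hypothesis. [folklore] -/
theorem iterate_Dθ_Dz_tensor (R G : ℝ → ℝ) (i j : ℕ) :
    Dθ^[i] (Dz^[j] (tensor R G)) = tensor (Dz₁^[j] R) (Dθ₁^[i] G) := by
  rw [iterate_Dz_tensor, iterate_Dθ_tensor]

/-- `Dθ₁` is homogeneous. [folklore] -/
theorem Dθ₁_const_mul (a : ℝ) (g : ℝ → ℝ) : Dθ₁ (fun θ => a * g θ) = fun θ => a * Dθ₁ g θ := by
  funext θ
  simp only [Dθ₁_apply, deriv_const_mul_field]
  ring

/-- Iterates of `Dθ₁` are homogeneous. [folklore] -/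
theorem iterate_Dθ₁_const_mul (a : ℝ) (g : ℝ → ℝ) (i : ℕ) :
    Dθ₁^[i] (fun θ => a * g θ) = fun θ => a * Dθ₁^[i] g θ := by
  induction i with
  | zero => rfl
  | succ i ih => rw [iterate_succ_apply', iterate_succ_apply', ih, Dθ₁_const_mul]

/-! ### `Dz₁`-iterates: vanishing, local constancy, dilations -/

/-- `Dz₁ c = 0` at a point near which `c` is constant. [folklore] -/
theorem Dz₁_eq_zero_of_eventuallyEq_const {c : ℝ → ℝ} {z a : ℝ} (h : c =ᶠ[𝓝 z] fun _ => a) :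
    Dz₁ c z = 0 := by
  rw [Dz₁_apply, h.deriv_eq]
  simp

/-- If `c` vanishes on an open set `U`, so do all its `Dz₁`-iterates. [folklore] -/
theorem iterate_Dz₁_eq_zero_of_eqOn {c : ℝ → ℝ} {U : Set ℝ} (hU : IsOpen U)
    (h : ∀ z ∈ U, c z = 0) (l : ℕ) : ∀ z ∈ U, Dz₁^[l] c z = 0 := by
  induction l with
  | zero => exact h
  | succ l ih =>
    intro z hz
    rw [iterate_succ_apply']
    apply Dz₁_eq_zero_of_eventuallyEq_const (a := 0)
    filter_upwards [hU.mem_nhds hz] with y hy using ih y hy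

/-- If `c` is constant on an open set `U`, its `Dz₁`-iterates of positive order vanish on `U`. [folklore] -/
theorem iterate_Dz₁_succ_eq_zero_of_const {c : ℝ → ℝ} {U : Set ℝ} (hU : IsOpen U) {a : ℝ}
    (h : ∀ z ∈ U, c z = a) (l : ℕ) : ∀ z ∈ U, Dz₁^[l + 1] c z = 0 := by
  have h1 : ∀ z ∈ U, Dz₁ c z = 0 := fun z hz =>
    Dz₁_eq_zero_of_eventuallyEq_const (by filter_upwards [hU.mem_nhds hz] with y hy using h y hy)
  intro z hz
  rw [iterate_succ_apply]
  exact iterate_Dz₁_eq_zero_of_eqOn hU h1 l z hz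

/-- **Dilation invariance of `Dz₁`**: `Dz₁ (g(·/M)) = (Dz₁ g)(·/M)` for differentiable `g`
(`z · g'(z/M)/M = (z/M) g'(z/M)`). [folklore] -/
theorem Dz₁_comp_div {g : ℝ → ℝ} (hg : Differentiable ℝ g) (M : ℝ) :
    Dz₁ (fun z => g (z / M)) = fun z => Dz₁ g (z / M) := by
  funext z
  have h : HasDerivAt (fun z => g (z / M)) (deriv g (z / M) * (1 / M)) z :=
    (hg (z / M)).hasDerivAt.comp z ((hasDerivAt_id' z).div_const M)
  rw [Dz₁_apply, h.deriv, Dz₁_apply]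
  ring

/-- **Dilation invariance of the iterates** (Elgindi–Ghoul–Masmoudi 2021, Remark 9.8: the bounds
on `D_z^j χ(·/M)` do not depend on `M`): `Dz₁^l (g(·/M)) = (Dz₁^l g)(·/M)` for smooth `g`. [cite: ElgindiGhoulMasmoudi2021, Remark 9.8 (p. 20 of arXiv:1910.14071)] -/
theorem iterate_Dz₁_comp_div {g : ℝ → ℝ} (hg : ∀ n : ℕ, ContDiff ℝ n g) (M : ℝ) (l : ℕ) :
    Dz₁^[l] (fun z => g (z / M)) = fun z => Dz₁^[l] g (z / M) := by
  induction l generalizing g with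
  | zero => rfl
  | succ l ih =>
    have hd : Differentiable ℝ g := (hg 1).differentiable (by norm_num)
    have hg' : ∀ n : ℕ, ContDiff ℝ n (Dz₁ g) := fun n => contDiff_Dz₁ (by exact_mod_cast hg (n + 1))
    rw [iterate_succ_apply, iterate_succ_apply, Dz₁_comp_div hd M, ih hg']

/-- Smooth functions have continuous `Dz₁`-iterates. [folklore] -/
theorem continuous_iterate_Dz₁ {g : ℝ → ℝ} (hg : ∀ n : ℕ, ContDiff ℝ n g) (l : ℕ) :
    Continuous (Dz₁^[l] g) :=
  (contDiff_iterate_Dz₁ (N := l) (m := 0) (hg l) le_rfl).continuous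

/-- A continuous function vanishing off `[a, b]` (outside, on the open rays) is bounded. [folklore] -/
theorem exists_abs_le_of_eq_zero_off {g : ℝ → ℝ} (hg : Continuous g) {a b : ℝ}
    (ha : ∀ z < a, g z = 0) (hb : ∀ z > b, g z = 0) : ∃ B : ℝ, 0 ≤ B ∧ ∀ z, |g z| ≤ B := by
  obtain ⟨C, hC⟩ := isCompact_Icc.exists_bound_of_continuousOn (hg.continuousOn (s := Icc a b))
  refine ⟨max C 0, le_max_right _ _, fun z => ?_⟩
  rcases lt_or_ge z a with h | h
  · rw [ha z h, abs_zero]; exact le_max_right _ _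
  rcases lt_or_ge b z with h' | h'
  · rw [hb z h', abs_zero]; exact le_max_right _ _
  exact ((Real.norm_eq_abs _).symm.le.trans (hC z ⟨h, h'⟩)).trans (le_max_left _ _)

/-! ### The cut-off profile and the cut-off `χ(z/M) − 1` -/

/-- The cut-off profile `ψ(t) = −smoothTransition(t − 1)`: a smooth version of `χ(t) − 1` for a
plateau function `χ` (`χ ≡ 1` on `[0,1]`, `χ ≡ 0` on `[2,∞)`, `0 ≤ χ ≤ 1`, Elgindi–Ghoul–Masmoudi
2021, §2.6). [cite: ElgindiGhoulMasmoudi2021, §2.6 (p. 9 of arXiv:1910.14071): the cut-off χ] -/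
def cutProfile (t : ℝ) : ℝ :=
  -Real.smoothTransition (t - 1)

/-- `ψ = 0` on `t ≤ 1`. [folklore] -/
theorem cutProfile_of_le_one {t : ℝ} (ht : t ≤ 1) : cutProfile t = 0 := by
  simp [cutProfile, Real.smoothTransition.zero_of_nonpos (sub_nonpos.2 ht)]

/-- `ψ = −1` on `t ≥ 2`. [folklore] -/
theorem cutProfile_of_two_le {t : ℝ} (ht : 2 ≤ t) : cutProfile t = -1 := by
  simp [cutProfile, Real.smoothTransition.one_of_one_le (show (1 : ℝ) ≤ t - 1 by linarith)]

/-- `|ψ| ≤ 1`. [folklore] -/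
theorem abs_cutProfile_le_one (t : ℝ) : |cutProfile t| ≤ 1 := by
  rw [cutProfile, abs_neg, abs_of_nonneg (Real.smoothTransition.nonneg _)]
  exact Real.smoothTransition.le_one _

/-- `ψ` is smooth (`ℕ∞` exponents). [folklore] -/
theorem contDiff_cutProfile_enat {n : ℕ∞} : ContDiff ℝ n cutProfile :=
  ((Real.smoothTransition.contDiff (n := n)).comp (contDiff_id.sub contDiff_const)).neg

/-- `ψ` is smooth. [folklore] -/
theorem contDiff_cutProfile (n : ℕ) : ContDiff ℝ n cutProfile :=
  contDiff_cutProfile_enat (n := n)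

/-- All `Dz₁`-iterates of `ψ` vanish on `t < 1`. [folklore] -/
theorem iterate_Dz₁_cutProfile_of_lt_one (l : ℕ) {t : ℝ} (ht : t < 1) : Dz₁^[l] cutProfile t = 0 :=
  iterate_Dz₁_eq_zero_of_eqOn isOpen_Iio (fun _ hz => cutProfile_of_le_one (le_of_lt hz)) l t ht

/-- The `Dz₁`-iterates of positive order of `ψ` vanish on `t > 2`. [folklore] -/
theorem iterate_Dz₁_succ_cutProfile_of_two_lt (l : ℕ) {t : ℝ} (ht : 2 < t) :
    Dz₁^[l + 1] cutProfile t = 0 :=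
  iterate_Dz₁_succ_eq_zero_of_const isOpen_Ioi (fun _ hz => cutProfile_of_two_le (le_of_lt hz)) l t ht

/-- **The `Dz₁`-iterates of `ψ` are bounded.** [folklore] -/
theorem exists_abs_iterate_Dz₁_cutProfile_le (l : ℕ) :
    ∃ B : ℝ, 0 ≤ B ∧ ∀ t, |Dz₁^[l] cutProfile t| ≤ B := by
  cases l with
  | zero => exact ⟨1, zero_le_one, abs_cutProfile_le_one⟩
  | succ l =>
    exact exists_abs_le_of_eq_zero_off (continuous_iterate_Dz₁ contDiff_cutProfile (l + 1))
      (fun z hz => iterate_Dz₁_cutProfile_of_lt_one (l + 1) hz)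
      (fun z hz => iterate_Dz₁_succ_cutProfile_of_two_lt l hz)

/-- A bound on the `Dz₁`-iterates of `ψ` of all orders `≤ k` at once. [folklore] -/
theorem exists_abs_iterate_Dz₁_cutProfile_le_of_le (k : ℕ) :
    ∃ B : ℝ, 0 ≤ B ∧ ∀ l, l ≤ k → ∀ t, |Dz₁^[l] cutProfile t| ≤ B := by
  induction k with
  | zero =>
    obtain ⟨B, hB0, hB⟩ := exists_abs_iterate_Dz₁_cutProfile_le 0
    exact ⟨B, hB0, fun l hl t => by rw [Nat.le_zero.mp hl]; exact hB t⟩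
  | succ k ih =>
    obtain ⟨B, hB0, hB⟩ := ih
    obtain ⟨B', -, hB'⟩ := exists_abs_iterate_Dz₁_cutProfile_le (k + 1)
    refine ⟨max B B', le_max_of_le_left hB0, fun l hl t => ?_⟩
    rcases Nat.lt_or_ge l (k + 1) with h | h
    · exact (hB l (Nat.lt_succ_iff.mp h) t).trans (le_max_left _ _)
    · rw [le_antisymm hl h]
      exact (hB' t).trans (le_max_right _ _)

/-- **The cut-off `χ(z/M) − 1`**: `tailCut M z = ψ(z/M)`, equal to `0` for `z ≤ M` and to `−1` for
`z ≥ 2M` (Elgindi–Ghoul–Masmoudi 2021, §2.6: the factor `χ(z/M) − 1` of `ε₀^{M,β}`). [cite: ElgindiGhoulMasmoudi2021, §2.6 (p. 9 of arXiv:1910.14071)] -/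
def tailCut (M : ℝ) (z : ℝ) : ℝ :=
  cutProfile (z / M)

/-- `tailCut M = 0` on `z ≤ M` (`M > 0`). [folklore] -/
theorem tailCut_of_le {M z : ℝ} (hM : 0 < M) (hz : z ≤ M) : tailCut M z = 0 :=
  cutProfile_of_le_one ((div_le_one hM).2 hz)

/-- `tailCut M = −1` on `z ≥ 2M` (`M > 0`). [folklore] -/
theorem tailCut_of_ge {M z : ℝ} (hM : 0 < M) (hz : 2 * M ≤ z) : tailCut M z = -1 :=
  cutProfile_of_two_le ((le_div_iff₀ hM).2 hz)

/-- `|tailCut M| ≤ 1`. [folklore] -/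
theorem abs_tailCut_le_one (M z : ℝ) : |tailCut M z| ≤ 1 := abs_cutProfile_le_one _

/-- `tailCut M` is smooth. [folklore] -/
theorem contDiff_tailCut (M : ℝ) (n : ℕ) : ContDiff ℝ n (tailCut M) :=
  (contDiff_cutProfile n).comp (contDiff_id.div_const M)

/-- `tailCut M` is continuous. [folklore] -/
theorem continuous_tailCut (M : ℝ) : Continuous (tailCut M) := (contDiff_tailCut M 0).continuous

/-- The `Dz₁`-iterates of `tailCut M` are the dilated iterates of `ψ`. [folklore] -/
theorem iterate_Dz₁_tailCut (M : ℝ) (l : ℕ) (z : ℝ) :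
    Dz₁^[l] (tailCut M) z = Dz₁^[l] cutProfile (z / M) := by
  have := iterate_Dz₁_comp_div contDiff_cutProfile M l
  exact congrFun this z

/-- **`M`-uniform bounds on the `Dz₁`-iterates of the cut-off** (Elgindi–Ghoul–Masmoudi 2021,
Remark 9.8): one constant bounds `|Dz₁^l (tailCut M)|` for all `l ≤ k`, all `M` and all `z`. [cite: ElgindiGhoulMasmoudi2021, Remark 9.8 (p. 20 of arXiv:1910.14071)] -/
theorem exists_abs_iterate_Dz₁_tailCut_le (k : ℕ) :
    ∃ B : ℝ, 0 ≤ B ∧ ∀ M, ∀ l, l ≤ k → ∀ z, |Dz₁^[l] (tailCut M) z| ≤ B := by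
  obtain ⟨B, hB0, hB⟩ := exists_abs_iterate_Dz₁_cutProfile_le_of_le k
  exact ⟨B, hB0, fun M l hl z => by rw [iterate_Dz₁_tailCut]; exact hB l hl _⟩

/-- `tailCut M` vanishes on the open ray `z < M` (`M > 0`), hence so do its `Dz₁`-iterates. [folklore] -/
theorem iterate_Dz₁_tailCut_of_lt {M : ℝ} (hM : 0 < M) (l : ℕ) {z : ℝ} (hz : z < M) :
    Dz₁^[l] (tailCut M) z = 0 :=
  iterate_Dz₁_eq_zero_of_eqOn isOpen_Iio (fun _ hy => tailCut_of_le hM (le_of_lt hy)) l z hz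

/-! ### The radial bump -/

/-- The radial bump `σ(z) = smoothTransition(z − 1) · smoothTransition(4 − z)`: smooth,
`0 ≤ σ ≤ 1`, `σ = 0` off `(1, 4)`, `σ > 0` on `(1, 4)` (a stand-in for the radial factor
`χ((z−3)²)` of the bump `β sin(2θ)χ((z−3)²)` of Elgindi–Ghoul–Masmoudi 2021, §2.6). [cite: ElgindiGhoulMasmoudi2021, §2.6 (p. 9 of arXiv:1910.14071): the bump χ((z−3)²)] -/
def bumpRadial (z : ℝ) : ℝ :=
  Real.smoothTransition (z - 1) * Real.smoothTransition (4 - z)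

/-- `σ = 0` on `z ≤ 1`. [folklore] -/
theorem bumpRadial_of_le_one {z : ℝ} (hz : z ≤ 1) : bumpRadial z = 0 := by
  simp [bumpRadial, Real.smoothTransition.zero_of_nonpos (sub_nonpos.2 hz)]

/-- `σ = 0` on `z ≥ 4`. [folklore] -/
theorem bumpRadial_of_four_le {z : ℝ} (hz : 4 ≤ z) : bumpRadial z = 0 := by
  simp [bumpRadial, Real.smoothTransition.zero_of_nonpos (sub_nonpos.2 hz)]

/-- `0 ≤ σ`. [folklore] -/
theorem bumpRadial_nonneg (z : ℝ) : 0 ≤ bumpRadial z :=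
  mul_nonneg (Real.smoothTransition.nonneg _) (Real.smoothTransition.nonneg _)

/-- `σ ≤ 1`. [folklore] -/
theorem bumpRadial_le_one (z : ℝ) : bumpRadial z ≤ 1 :=
  mul_le_one₀ (Real.smoothTransition.le_one _) (Real.smoothTransition.nonneg _)
    (Real.smoothTransition.le_one _)

/-- `|σ| ≤ 1`. [folklore] -/
theorem abs_bumpRadial_le_one (z : ℝ) : |bumpRadial z| ≤ 1 := by
  rw [abs_of_nonneg (bumpRadial_nonneg z)]
  exact bumpRadial_le_one z

/-- `σ > 0` on `(1, 4)`. [folklore] -/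
theorem bumpRadial_pos {z : ℝ} (hz : z ∈ Ioo 1 4) : 0 < bumpRadial z :=
  mul_pos (Real.smoothTransition.pos_of_pos (by linarith [hz.1]))
    (Real.smoothTransition.pos_of_pos (by linarith [hz.2]))

/-- `σ` is smooth (`ℕ∞` exponents). [folklore] -/
theorem contDiff_bumpRadial_enat {n : ℕ∞} : ContDiff ℝ n bumpRadial :=
  ((Real.smoothTransition.contDiff (n := n)).comp (contDiff_id.sub contDiff_const)).mul
    ((Real.smoothTransition.contDiff (n := n)).comp (contDiff_const.sub contDiff_id))

/-- `σ` is smooth. [folklore] -/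
theorem contDiff_bumpRadial (n : ℕ) : ContDiff ℝ n bumpRadial :=
  contDiff_bumpRadial_enat (n := n)

/-- `σ` is continuous. [folklore] -/
theorem continuous_bumpRadial : Continuous bumpRadial := (contDiff_bumpRadial 0).continuous

/-- All `Dz₁`-iterates of `σ` vanish on `z < 1`. [folklore] -/
theorem iterate_Dz₁_bumpRadial_of_lt_one (l : ℕ) {z : ℝ} (hz : z < 1) : Dz₁^[l] bumpRadial z = 0 :=
  iterate_Dz₁_eq_zero_of_eqOn isOpen_Iio (fun _ hy => bumpRadial_of_le_one (le_of_lt hy)) l z hz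

/-- All `Dz₁`-iterates of `σ` vanish on `z > 4`. [folklore] -/
theorem iterate_Dz₁_bumpRadial_of_four_lt (l : ℕ) {z : ℝ} (hz : 4 < z) : Dz₁^[l] bumpRadial z = 0 :=
  iterate_Dz₁_eq_zero_of_eqOn isOpen_Ioi (fun _ hy => bumpRadial_of_four_le (le_of_lt hy)) l z hz

/-- **The `Dz₁`-iterates of `σ` of all orders `≤ k` are bounded by one constant.** [folklore] -/
theorem exists_abs_iterate_Dz₁_bumpRadial_le (k : ℕ) :
    ∃ B : ℝ, 0 ≤ B ∧ ∀ l, l ≤ k → ∀ z, |Dz₁^[l] bumpRadial z| ≤ B := by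
  have hone : ∀ l, ∃ B : ℝ, 0 ≤ B ∧ ∀ z, |Dz₁^[l] bumpRadial z| ≤ B := fun l =>
    exists_abs_le_of_eq_zero_off (continuous_iterate_Dz₁ contDiff_bumpRadial l)
      (fun z hz => iterate_Dz₁_bumpRadial_of_lt_one l hz)
      (fun z hz => iterate_Dz₁_bumpRadial_of_four_lt l hz)
  induction k with
  | zero =>
    obtain ⟨B, hB0, hB⟩ := hone 0
    exact ⟨B, hB0, fun l hl z => by rw [Nat.le_zero.mp hl]; exact hB z⟩
  | succ k ih =>
    obtain ⟨B, hB0, hB⟩ := ih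
    obtain ⟨B', -, hB'⟩ := hone (k + 1)
    refine ⟨max B B', le_max_of_le_left hB0, fun l hl z => ?_⟩
    rcases Nat.lt_or_ge l (k + 1) with h | h
    · exact (hB l (Nat.lt_succ_iff.mp h) z).trans (le_max_left _ _)
    · rw [le_antisymm hl h]
      exact (hB' z).trans (le_max_right _ _)

end Elgindi

end Literature.Analysis.FluidPDE
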